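import Mathlib
import HarnessLib.Audit
import Summits.PneNP.PneNP.Theorems.PstarGConstraint

/-!
# The two-block coincidence table: local second readers against `x_a x_b ⊕ x_c x_d` (ROUND-24, O1; memo g26 §67)

FRONTIER range-avoidance ladder, rung F-N3, ROUND 24 (cell `pnp-ideate`, prover-2 memo `g26/O1-LOCALITY-g26.md` §67; census node
`PstarSharpGateBudgetAssembly.SharpMenuCriterionBoundGateBudget`, branch (B) = `PstarCoincidenceExact.NoCoincidenceExact`; restricted-model proof
complexity — nothing here bears on `P` versus `NP`).

Companion of `PstarPendantCoincidence` (the one-block shape `x_s(x_p ⊕ x_q)`).  The other rank-4 shape of a coincidence fold set `F₁ = {f₁, f₂}` is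
TWO DISJOINT AND PAIRS `(a, b)`, `(c, d)`: `R₁ = x_a x_b ⊕ x_c x_d` — e.g. `{t₂, o₀}` behind the second chord `(v₂, ℓ₀)` at a pendant partner, two
dirty chords `{d, d'}` closing a triangle with a clean one, or `{t_i, d}`.  By `PstarLocalCriterion.coincidence_trunc` only LOCAL second readers
matter: linear part inside `{a, b, c, d}` (bits `A, B, C, D`) and monomials among the six pairs (parity bits `Mab, Mcd` for the two fold pairs,
`Mac, Mad, Mbc, Mbd` for the four CROSS pairs).  The complete table, kernel-checked by `decide`:

* **`unsat_true_iff`** — at slice value `β₁ = 1` (exactly one of the two products is on) the local reader is a coincidence iff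
  `Mab = Mcd`, `A = Mac ⊕ Mad`, `B = Mbc ⊕ Mbd`, `C = Mac ⊕ Mbc`, `D = Mad ⊕ Mbd` — the cross matrix is free and the linear reads are its row and
  column sums (32 readers; e.g. the free `σσ′` menu `x_a x_c ⊕ x_a ⊕ x_c = (1 ⊕ x_a)(1 ⊕ x_c) ⊕ 1` of the census);
* **`unsat_false_iff`** — at `β₁ = 0` only the degenerate readers `0`, `R₁` (no genuine coincidence);
* `coincidence_iff_of_eval` — the bridge from an instance: whenever the two readers evaluate as `R₁`, `localVal`, joint unsatisfiability over all
  assignments is exactly `Unsat`; `gval_twoBlock_eq` evaluates `R₁`; `gval_cross_eq` evaluates the typical local reader (linear reads + the two folds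
  + one cross monomial).

So on two-block fold sets NO linear (`∅`-menu) reader is a coincidence, and a certifying menu needs a CROSS monomial whose two linear partners are
read — for all `k`.
-/

set_option linter.dupNamespace false -- `Summit.PneNP.PneNP.…`: summit = sub-problem name (D-0017 single-conjunct layout)

open Finset Literature.Computability.Complexity
open Summit.PneNP.PneNP.Theorems.PstarFibrePolys (bit bit_xor bit_and bit_injective)
open Summit.PneNP.PneNP.Theorems.PstarGapOneAll (gval)
open Summit.PneNP.PneNP.Theorems.PstarGConstraint (bit_gval)

namespace Summit.PneNP.PneNP.Theorems.PstarTwoBlockCoincidence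

variable {n m : ℕ}

/-! ## The finite table -/

/-- The local second reader as a Boolean function of `(x_a, x_b, x_c, x_d)`: linear bits `A B C D`, fold-pair bits `Mab Mcd`, cross bits
`Mac Mad Mbc Mbd`. -/
def localVal (A B C D Mab Mcd Mac Mad Mbc Mbd a b c d : Bool) : Bool :=
  xor (xor (xor (A && a) (B && b)) (xor (C && c) (D && d)))
    (xor (xor (Mab && (a && b)) (Mcd && (c && d))) (xor (xor (Mac && (a && c)) (Mad && (a && d))) (xor (Mbc && (b && c)) (Mbd && (b && d)))))

/-- The finite unsatisfiability condition: no `(a, b, c, d)` with `ab ⊕ cd = β₁` and `localVal = β₂`. -/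
def Unsat (β₁ β₂ A B C D Mab Mcd Mac Mad Mbc Mbd : Bool) : Prop :=
  ∀ a b c d : Bool, xor (a && b) (c && d) = β₁ → localVal A B C D Mab Mcd Mac Mad Mbc Mbd a b c d ≠ β₂

/-- **Slice value `1`: the cross-matrix rule.**  A coincidence iff the fold bits agree and the linear reads are the row and column sums of the
cross matrix; the target is then forced. -/
theorem unsat_true_iff (β₂ A B C D Mab Mcd Mac Mad Mbc Mbd : Bool) :
    Unsat true β₂ A B C D Mab Mcd Mac Mad Mbc Mbd ↔
      Mab = Mcd ∧ A = xor Mac Mad ∧ B = xor Mbc Mbd ∧ C = xor Mac Mbc ∧ D = xor Mad Mbd ∧ β₂ = !(xor (xor A B) Mab) := by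
  unfold Unsat localVal
  cases β₂ <;> cases A <;> cases B <;> cases C <;> cases D <;> cases Mab <;> revert Mcd Mac Mad Mbc Mbd <;> decide

/-- **Slice value `0`: only degenerate readers** (`0` or `R₁` itself, target `1`). -/
theorem unsat_false_iff (β₂ A B C D Mab Mcd Mac Mad Mbc Mbd : Bool) :
    Unsat false β₂ A B C D Mab Mcd Mac Mad Mbc Mbd ↔
      A = false ∧ B = false ∧ C = false ∧ D = false ∧ Mac = false ∧ Mad = false ∧ Mbc = false ∧ Mbd = false ∧ Mab = Mcd ∧ β₂ = true := by
  unfold Unsat localVal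
  cases β₂ <;> cases A <;> cases B <;> cases C <;> cases D <;> cases Mab <;> revert Mcd Mac Mad Mbc Mbd <;> decide

/-- In particular no LINEAR local reader (all monomial bits `0`, some linear bit `1`) is ever a coincidence on a two-block fold set. -/
theorem not_unsat_linear (β₁ β₂ A B C D : Bool) (hlin : (A || B || C || D) = true) :
    ¬ Unsat β₁ β₂ A B C D false false false false false false := by
  cases β₁
  · rw [unsat_false_iff]
    revert hlin; cases A <;> cases B <;> cases C <;> cases D <;> simp
  · rw [unsat_true_iff]
    revert hlin; cases A <;> cases B <;> cases C <;> cases D <;> simp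

/-! ## The bridge from an instance -/
section Instance

variable (I : LocalMap 4 n m) {f₁ f₂ g : Fin m} {a b c d : Fin n}

/-- In `𝔽₂`: `bit (ab ⊕ cd) = bit a · bit b + bit c · bit d`. -/
private theorem bit_two (a b c d : Bool) : bit (xor (a && b) (c && d)) = bit a * bit b + bit c * bit d := by
  cases a <;> cases b <;> cases c <;> cases d <;> decide

/-- **The first reader**: `gval ∅ {f₁, f₂} = x_a x_b ⊕ x_c x_d` for members with AND pairs `(a, b)`, `(c, d)`. -/
theorem gval_twoBlock_eq (hne : f₁ ≠ f₂) (h₁ : I.vars f₁ 2 = a ∧ I.vars f₁ 3 = b) (h₂ : I.vars f₂ 2 = c ∧ I.vars f₂ 3 = d) (z : Fin n → Bool) :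
    gval I ∅ {f₁, f₂} z = xor (z a && z b) (z c && z d) := by
  classical
  apply bit_injective
  rw [bit_gval, sum_empty, zero_add, sum_pair hne, h₁.1, h₁.2, h₂.1, h₂.2, bit_two]

/-- **A typical local reader evaluated**: linear reads `Cl ⊆ {a, b, c, d}`, both/neither fold, and ONE cross output `g` of AND pair `(a, c)` (the
`σσ′` monomial of the census) possibly present: `gval Cl G₂ = localVal` with the corresponding bits. -/
theorem gval_cross_eq (hab : a ≠ b) (hac : a ≠ c) (had : a ≠ d) (hbc : b ≠ c) (hbd : b ≠ d) (hcd : c ≠ d)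
    (hne : f₁ ≠ f₂) (h1g : f₁ ≠ g) (h2g : f₂ ≠ g) (h₁ : I.vars f₁ 2 = a ∧ I.vars f₁ 3 = b) (h₂ : I.vars f₂ 2 = c ∧ I.vars f₂ 3 = d)
    (hg : (I.vars g 2 = a ∧ I.vars g 3 = c) ∨ (I.vars g 2 = c ∧ I.vars g 3 = a))
    {Cl : Finset (Fin n)} (hC : Cl ⊆ {a, b, c, d}) {G₂ : Finset (Fin m)} (hG : G₂ ⊆ {f₁, f₂, g}) (z : Fin n → Bool) :
    gval I Cl G₂ z = localVal (decide (a ∈ Cl)) (decide (b ∈ Cl)) (decide (c ∈ Cl)) (decide (d ∈ Cl)) (decide (f₁ ∈ G₂)) (decide (f₂ ∈ G₂))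
      (decide (g ∈ G₂)) false false false (z a) (z b) (z c) (z d) := by
  classical
  apply bit_injective
  rw [bit_gval]
  have hlin : ∑ v ∈ Cl, bit (z v) = ∑ v ∈ ({a, b, c, d} : Finset (Fin n)), (if v ∈ Cl then bit (z v) else 0) := by
    rw [← sum_filter]
    exact sum_congr (by ext v; rw [mem_filter]; exact ⟨fun h => ⟨hC h, h⟩, fun h => h.2⟩) fun _ _ => rfl
  have hmon : ∑ j ∈ G₂, bit (z (I.vars j 2)) * bit (z (I.vars j 3)) =
      ∑ j ∈ ({f₁, f₂, g} : Finset (Fin m)), (if j ∈ G₂ then bit (z (I.vars j 2)) * bit (z (I.vars j 3)) else 0) := by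
    rw [← sum_filter]
    exact sum_congr (by ext j; rw [mem_filter]; exact ⟨fun h => ⟨hG h, h⟩, fun h => h.2⟩) fun _ _ => rfl
  have ha' : a ∉ ({b, c, d} : Finset (Fin n)) := by simp [hab, hac, had]
  have hb' : b ∉ ({c, d} : Finset (Fin n)) := by simp [hbc, hbd]
  have hc' : c ∉ ({d} : Finset (Fin n)) := by simp [hcd]
  have h1' : f₁ ∉ ({f₂, g} : Finset (Fin m)) := by simp [hne, h1g]
  have h2' : f₂ ∉ ({g} : Finset (Fin m)) := by simp [h2g]
  have hgm : bit (z (I.vars g 2)) * bit (z (I.vars g 3)) = bit (z a) * bit (z c) := by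
    rcases hg with ⟨h2, h3⟩ | ⟨h2, h3⟩
    · rw [h2, h3]
    · rw [h2, h3, mul_comm]
  have key : ∀ (P : Prop) [Decidable P] (x : ZMod 2), (if P then x else 0) = bit (decide P) * x := fun P _ x => by
    by_cases h : P <;> simp [h, bit]
  rw [hlin, hmon, sum_insert ha', sum_insert hb', sum_insert hc', sum_singleton, sum_insert h1', sum_insert h2', sum_singleton,
    h₁.1, h₁.2, h₂.1, h₂.2, hgm, key, key, key, key, key, key, key]
  unfold localVal
  simp only [bit_xor, bit_and]
  simp [bit]
  ring

/-- **THE BRIDGE.**  If on the instance the first reader evaluates as `x_a x_b ⊕ x_c x_d` and the second as `localVal` of some bits, then joint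
unsatisfiability over all assignments is exactly the finite condition `Unsat` (the four variables being distinct, every `(a,b,c,d)` pattern occurs). -/
theorem coincidence_iff_of_eval (hab : a ≠ b) (hac : a ≠ c) (had : a ≠ d) (hbc : b ≠ c) (hbd : b ≠ d) (hcd : c ≠ d)
    {R₁ R₂ : (Fin n → Bool) → Bool} {A B C D Mab Mcd Mac Mad Mbc Mbd : Bool}
    (hR₁ : ∀ z, R₁ z = xor (z a && z b) (z c && z d))
    (hR₂ : ∀ z, R₂ z = localVal A B C D Mab Mcd Mac Mad Mbc Mbd (z a) (z b) (z c) (z d)) (β₁ β₂ : Bool) :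
    (∀ z : Fin n → Bool, ¬ (R₁ z = β₁ ∧ R₂ z = β₂)) ↔ Unsat β₁ β₂ A B C D Mab Mcd Mac Mad Mbc Mbd := by
  constructor
  · intro h xa xb xc xd habcd hval
    set z : Fin n → Bool :=
      Function.update (Function.update (Function.update (Function.update (fun _ => false) a xa) b xb) c xc) d xd with hz
    have hza : z a = xa := by
      rw [hz, Function.update_of_ne had, Function.update_of_ne hac, Function.update_of_ne hab, Function.update_self]
    have hzb : z b = xb := by rw [hz, Function.update_of_ne hbd, Function.update_of_ne hbc, Function.update_self]
    have hzc : z c = xc := by rw [hz, Function.update_of_ne hcd, Function.update_self]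
    have hzd : z d = xd := by rw [hz, Function.update_self]
    refine h z ⟨?_, ?_⟩
    · rw [hR₁, hza, hzb, hzc, hzd]; exact habcd
    · rw [hR₂, hza, hzb, hzc, hzd]; exact hval
  · rintro h z ⟨e₁, e₂⟩
    rw [hR₁] at e₁
    rw [hR₂] at e₂
    exact h _ _ _ _ e₁ e₂

/-- **Corollary (typical census entry): the `σσ′` cross monomial with both literals read certifies at slice value `1`.**  With `Cl = {a, c}` and
`G₂ = {g}` (AND pair `{a, c}`): `R₁ = 1 ∧ R₂ = 0` is unsatisfiable — `R₂ = x_a ⊕ x_c ⊕ x_a x_c ≡ 1` whenever exactly one of the products is on. -/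
theorem coincidence_sigma_pair (hab : a ≠ b) (hac : a ≠ c) (had : a ≠ d) (hbc : b ≠ c) (hbd : b ≠ d) (hcd : c ≠ d)
    (hne : f₁ ≠ f₂) (h1g : f₁ ≠ g) (h2g : f₂ ≠ g) (h₁ : I.vars f₁ 2 = a ∧ I.vars f₁ 3 = b) (h₂ : I.vars f₂ 2 = c ∧ I.vars f₂ 3 = d)
    (hg : (I.vars g 2 = a ∧ I.vars g 3 = c) ∨ (I.vars g 2 = c ∧ I.vars g 3 = a)) :
    ∀ z : Fin n → Bool, ¬ (gval I ∅ {f₁, f₂} z = true ∧ gval I {a, c} {g} z = false) := by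
  have hC : ({a, c} : Finset (Fin n)) ⊆ {a, b, c, d} := by
    intro v hv; simp only [mem_insert, mem_singleton] at hv ⊢; tauto
  have hG : ({g} : Finset (Fin m)) ⊆ {f₁, f₂, g} := by intro j hj; simp only [mem_insert, mem_singleton] at hj ⊢; tauto
  rw [coincidence_iff_of_eval hab hac had hbc hbd hcd (gval_twoBlock_eq I hne h₁ h₂)
    (gval_cross_eq I hab hac had hbc hbd hcd hne h1g h2g h₁ h₂ hg hC hG), unsat_true_iff]
  simp [hab.symm, hac, hac.symm, hbc, h1g, h2g, had.symm, hcd.symm]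

end Instance

end Summit.PneNP.PneNP.Theorems.PstarTwoBlockCoincidence
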